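import Summits.Ventures.LatticeQCDFlow.Scaling.TaggedResidualIncome
import Summits.Ventures.LatticeQCDFlow.Scaling.StarOccupationComparison
import Summits.Ventures.LatticeQCDFlow.Scaling.TaggedDomination

/-!
HONEST FRAMING: exact (Metropolis-corrected) sampling algorithms for lattice gauge theory; figures
of merit are autocorrelation/cost numbers at stated couplings and volumes; no continuum-physics
claim.

# TaggedCostSideResidual — THE COST SIDE OF ROUTE (β) AND CONJECTURE W′ FOR THE RESIDUAL PAIR (THE HUB CONTENT ALONE, EVERY OTHER PRESENT CONTENT STRICTLY BELOW IT, BOTH EXTRA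
# PARTICLES AT OR ABOVE IT), EVERY `K ≥ 2`: THE INCOME OF ALL ATTEMPTS THROUGH THE TWO-STATE SUB-CHAIN `{z, ★}` PAYS GEN-41 FILE 6 (B)'S BUDGET (lean-2 GEN-42, ours)

Venture-side (OURS).  Cell `lqcd-flow` (pub-lqcd), unit `pub-lqcd-lean-2-g42`, 2026-08-30.  Chapter AB (route (β), the cost side continued), file 7b.  Configuration (B) of GEN-41 file 6
(`N_C(z) = 1`, `W_w < W_z` for every other present `w`, `W_z ≤ W_b ≤ W_a`, `W_z < W_a`, no present content strictly between `W_b` and `W_a`): the budget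
`D_J ≤ (1−σ)(α/(1+α))(1/K)(σ/K)/(1−σ²/K²)` (`α = W_z/W_a`) is typed there; the first two attempts' income does NOT pay it (MEMO-gen41 §4 (ii): all steps' slack is needed).  Here:
from the hub, `P_X(z,z) = (1−α)/K`, `P_X(z,★) = α/K`, `P_X(★,z) = 1/K`, so the tail resolvent satisfies `x̃(z) ≥ (1−σ)(1−α)/K + σ[x̃(z)(1−α)/K + x̃(★)/K]`,
`x̃(★) ≥ (α/K)[(1−σ) + σx̃(z)]`, whence `(1−σ) + σx̃(z) ≥ (1−σ)/det`, `det = (1 − σ/K)(1 + σα/K)`; with GEN-41 file 4's exact `s1 = (1−σ)slack(z) + σE_x̃[slack] + …`,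
`E_x̃[slack] ≥ x̃(z)slack(z) + x̃(★)slack(★)`, GEN-41 file 7's hub slack `slack(z) ≥ α(K−2+3θ_a)/K` (the hub holds with probability `(1−α)/K ≤ N_C(z)/K`) and
`slack(★) ≥ θ_z − θ_a ≥ (1−α)(1−θ_a)/(1+α)` (every present content lies at or below `z`):  `s1 ≥ (1−σ)[α(K−2+3θ_a)/K + σ(α/K)(1−α)(1−θ_a)/(1+α)]/det`.  The scalar
inequality against the budget (`L ≤ 4K+2`, `θ_a ≥ ½`) is `K(K+σ)[(2K−1)(1+α) + σ(1−α)] − (4K+2)σ(K+σα) ≥ (2K³−2K²−3K) + α(2K³−6K−2) ≥ 0` (toy `numerics42/configB_scalar.py`: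
ratio ≥ 1.2, attained at `K = 2`).

* **`tagged_costSide_residual`** (`L·D_J ≤ 2s1`) and **`tagged_perAttempt_certificate_residual`** (Conjecture W′: `cost(x̃) + cost(ỹ) ≤ L·(x̃(★) + (x̃(a)−ỹ(a)) − D_J)` for every `J`);
  the scalar inequality and the kernel lemmas are file 7a (`TaggedResidualIncome`).

With files 2 ∕ 6 and GEN-41 file 10, Conjecture W′ is typed on every depth-adjacent edge off the exact ties (and on every edge in the deep configuration).  Literature grade (cell rule):
OWN; nothing cited; no new bib keys.
-/

open Finset

namespace Summit.Ventures.LatticeQCDFlow.Scaling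

/-! ### The cost side and Conjecture W′ for the residual pair -/
section ResidualCost
variable {S : Type*} [Fintype S] [DecidableEq S]
variable {W θ : S → ℝ} {acc : S → S → ℝ} {p : ℝ} {K : ℕ} {NC : S → ℕ} {a b : S} {PX PY : Option S → Option S → ℝ}

/-- **THE COST-SIDE INEQUALITY FOR THE RESIDUAL PAIR, EVERY `K ≥ 2`:** `L·Σ_{n<J}(1−σ)σⁿ(y_{n+1}(z) − x_{n+1}(z))⁺ ≤ 2·s1` (all attempts' income). [ours] -/
theorem tagged_costSide_residual (hW : ∀ v, 0 < W v) (hp0 : 0 ≤ p) (hp : ∀ v, p * W v ≤ 1) (hθ : ∀ v, θ v = 1 / (1 + p * W v))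
    (hacc : ∀ h v, acc h v = min 1 (W h / W v)) (hK : 2 ≤ K) (hNC : ∑ v, NC v = K) (hab : W b ≤ W a)
    (hnone : ∀ w, NC w ≠ 0 → ¬ (W b < W w ∧ W w < W a))
    (hPXoff : ∀ h v, h ≠ v → PX (some h) (some v) = if NC h = 0 then 0 else (NC v : ℝ) / K * acc h v)
    (hPXin : ∀ h, PX (some h) none = if NC h = 0 then 0 else acc h a / K)
    (hPXdiag : ∀ h, PX (some h) (some h) = 1 - (∑ v ∈ univ.erase h, PX (some h) (some v) + PX (some h) none))
    (hPXout : ∀ v, PX none (some v) = (NC v : ℝ) / K * acc a v) (hPXstay : PX none none = 1 - ∑ v, PX none (some v))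
    (hPYoff : ∀ h v, h ≠ v → PY (some h) (some v) = if NC h = 0 then 0 else (NC v : ℝ) / K * acc h v)
    (hPYin : ∀ h, PY (some h) none = if NC h = 0 then 0 else acc h b / K)
    (hPYdiag : ∀ h, PY (some h) (some h) = 1 - (∑ v ∈ univ.erase h, PY (some h) (some v) + PY (some h) none))
    (hPYout : ∀ v, PY none (some v) = (NC v : ℝ) / K * acc b v) (hPYstay : PY none none = 1 - ∑ v, PY none (some v))
    {z : S} (hz1 : NC z = 1) (hzb : W z ≤ W b) (hza : W z < W a) (hbelow : ∀ w, w ≠ z → NC w ≠ 0 → W w < W z)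
    {x y : ℕ → Option S → ℝ}
    (hx0 : ∀ v, x 0 v = if v = some z then 1 else 0) (hxs : ∀ n v, x (n + 1) v = ∑ h, x n h * PX h v)
    (hy0 : ∀ v, y 0 v = if v = some z then 1 else 0) (hys : ∀ n v, y (n + 1) v = ∑ h, y n h * PY h v)
    {M : ℝ} (hM : M = ∑ v, θ v * (NC v : ℝ) + θ a) {L : ℝ} (hL : L = 2 * K + M + (∑ v, θ v * (NC v : ℝ) + θ b))
    {σ : ℝ} (hσ0 : 0 ≤ σ) (hσ1 : σ < 1) {ut : Option S → ℝ} (hut : ∀ t, ut t = (1 - σ) * PX (some z) t + σ * ∑ t', ut t' * PX t' t) (J : ℕ) :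
    L * ∑ n ∈ range J, (1 - σ) * σ ^ n * max 0 (y (n + 1) (some z) - x (n + 1) (some z))
      ≤ 2 * ((K + M) * ut none - (∑ v, ut (some v) * (1 - θ v) + ut none * (1 - θ a))) := by
  have hz : NC z ≠ 0 := by rw [hz1]; exact one_ne_zero
  have hK1 : 1 ≤ K := by omega
  have hK0 : (0 : ℝ) < K := by exact_mod_cast (show 0 < K by omega)
  have hK2r : (2 : ℝ) ≤ K := by exact_mod_cast hK
  have hθm := theta_mem hW hp0 hp hθ
  -- the deficit budget (GEN-41 file 6 (B))
  obtain ⟨-, hB, -, -⟩ := tagged_startClass_deficit hW hacc hK hNC hab hnone hPXoff hPXin hPXdiag hPXout hPXstay hPYoff hPYin hPYdiag hPYout hPYstay hz hx0 hxs hy0 hys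
  obtain ⟨-, hD⟩ := hB hzb hza hz1 hbelow
  have hDJ := hD σ hσ0 hσ1 J
  -- the certificate slack (GEN-41 file 4)
  obtain ⟨r, hr⟩ : ∃ r : Option S → ℝ, ∀ t, r t = Option.elim t ((K + M) - (1 - θ a)) (fun v => -(1 - θ v)) := ⟨_, fun _ => rfl⟩
  obtain ⟨Λ, hΛ⟩ : ∃ Λ : Option S → ℝ, ∀ t, Λ t = Option.elim t (-(1 - θ a)) (fun _ => 0) := ⟨_, fun _ => rfl⟩
  obtain ⟨sl, hsl⟩ : ∃ sl : Option S → ℝ, ∀ t, sl t = ∑ t', PX t t' * (r t' + Λ t') - Λ t := ⟨_, fun _ => rfl⟩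
  have hrn : r none = (K + M) - (1 - θ a) := by rw [hr]; rfl
  have hrs : ∀ v, r (some v) = -(1 - θ v) := fun v => by rw [hr]; rfl
  have hΛn : Λ none = -(1 - θ a) := by rw [hΛ]; rfl
  have hΛs : ∀ v, Λ (some v) = 0 := fun v => by rw [hΛ]; rfl
  have heq := ledger_tail_eq hsl hut
  have hP0 := tagged_nonneg hW hacc hPXoff hPXin hPXdiag hPXout hPXstay hK1 hNC
  have hP1 := tagged_rowsum (P := PX) hPXdiag hPXstay
  have hut0 : ∀ t, 0 ≤ ut t := geomResolvent_nonneg hP0 hP1 hσ0 hσ1 (ν := fun t => PX (some z) t) (fun t => hP0 _ _) hut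
  have hsl_none : 0 ≤ sl none := by
    rw [hsl]; linarith only [tagged_supersolution_none hW hp0 hp hθ hacc hPXout hPXstay hK1 hNC hM hrn hrs hΛn hΛs]
  have hsl_some : ∀ v, NC v ≠ 0 → 0 ≤ sl (some v) := fun v hv => by
    rw [hsl]; linarith only [tagged_supersolution_some hW hp0 hp hθ hacc hPXoff hPXin hPXdiag hK1 hNC hM hrn hrs hΛn hΛs hv]
  have habs : ∀ w, NC w = 0 → ut (some w) = 0 := fun w hw =>
    tagged_tail_absent hW hacc hPXoff hPXin hPXdiag hPXout hPXstay hK1 hNC hσ0 hσ1 hz hut hw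
  have hΛz : Λ (some z) = 0 := hΛs z
  have hEΛ : ∑ t, ut t * Λ t = -(1 - θ a) * ut none := by rw [tagged_sum_option, hΛn]; simp [hΛs]; ring
  have hEr : ∑ t, ut t * r t = (K + M) * ut none - (∑ v, ut (some v) * (1 - θ v) + ut none * (1 - θ a)) := by
    rw [tagged_sum_option, hrn]; simp only [hrs]
    have e : ∑ v, ut (some v) * -(1 - θ v) = -∑ v, ut (some v) * (1 - θ v) := by rw [← sum_neg_distrib]; exact sum_congr rfl fun v _ => by ring
    rw [e]; ring
  have hs1eq : (K + M) * ut none - (∑ v, ut (some v) * (1 - θ v) + ut none * (1 - θ a))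
      = (1 - σ) * sl (some z) + σ * ∑ t, ut t * sl t + (1 - σ) * ((1 - θ a) * ut none) := by
    rw [← hEr, heq, hΛz, hEΛ]; ring
  have htail0 : 0 ≤ (1 - σ) * ((1 - θ a) * ut none) :=
    mul_nonneg (by linarith only [hσ1]) (mul_nonneg (by linarith only [(hθm a).2]) (hut0 none))
  -- `E_ũ[slack] ≥ ũ(z)slack(z) + ũ(★)slack(★)`
  have hE : ut (some z) * sl (some z) + ut none * sl none ≤ ∑ t, ut t * sl t := by
    rw [tagged_sum_option, ← add_sum_erase univ (fun v => ut (some v) * sl (some v)) (mem_univ z)]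
    have hrest : 0 ≤ ∑ v ∈ univ.erase z, ut (some v) * sl (some v) := by
      refine sum_nonneg fun v _ => ?_
      by_cases hv : NC v = 0
      · rw [habs v hv, zero_mul]
      · exact mul_nonneg (hut0 _) (hsl_some v hv)
    linarith
  -- the kernel data of the residual pair
  set α := acc z a with hαdef
  have hαeq : α = W z / W a := by rw [hαdef, hacc]; exact min_eq_right ((div_le_one (hW a)).mpr hza.le)
  have hα0 : 0 ≤ α := starHub_acc_nonneg hW hacc z a
  have hα1 : α ≤ 1 := by rw [hαdef, hacc]; exact min_le_left _ _
  have hoff := costSide_residual_offsum hW hacc hK1 hNC hPXoff hz1 hbelow (PX := PX)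
  have hPzn : PX (some z) none = α / K := by rw [hPXin, if_neg hz]
  have hPzz : PX (some z) (some z) = (1 - α) / K := by
    rw [hPXdiag, hoff, hPzn]; field_simp; ring
  have hPnz : PX none (some z) = 1 / K := by
    rw [hPXout, hz1, hacc, min_eq_left ((one_le_div (hW z)).mpr hza.le)]; simp
  -- the two resolvent inequalities on `{z, ★}`
  have huz : (1 - σ) * ((1 - α) / K) + σ * (ut (some z) * ((1 - α) / K) + ut none * (1 / K)) ≤ ut (some z) := by
    have h := hut (some z)
    rw [hPzz, tagged_sum_option, hPnz, ← add_sum_erase univ (fun v => ut (some v) * PX (some v) (some z)) (mem_univ z), hPzz] at h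
    have hrest : 0 ≤ ∑ v ∈ univ.erase z, ut (some v) * PX (some v) (some z) := sum_nonneg fun v _ => mul_nonneg (hut0 _) (hP0 _ _)
    have hσrest := mul_nonneg hσ0 hrest
    linarith [h, hσrest]
  have hun : (1 - σ) * (α / K) + σ * (ut (some z) * (α / K)) ≤ ut none := by
    have h := hut none
    rw [hPzn, tagged_sum_option, ← add_sum_erase univ (fun v => ut (some v) * PX (some v) none) (mem_univ z), hPzn] at h
    have hrest : 0 ≤ ∑ v ∈ univ.erase z, ut (some v) * PX (some v) none := sum_nonneg fun v _ => mul_nonneg (hut0 _) (hP0 _ _)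
    have hnn : 0 ≤ ut none * PX none none := mul_nonneg (hut0 _) (hP0 _ _)
    have hσrest := mul_nonneg hσ0 (add_nonneg hnn hrest)
    linarith [h, hσrest]
  -- `A = (1−σ) + σũ(z) ≥ (1−σ)/det`, `det = (1 − σ/K)(1 + σα/K)`
  set A := (1 - σ) + σ * ut (some z) with hAdef
  have hA0 : 0 ≤ A := by rw [hAdef]; linarith [mul_nonneg hσ0 (hut0 (some z))]
  have hσK : σ / K ≤ 1 / 2 := by rw [div_le_iff₀ hK0]; linarith
  have hdet1 : 0 < 1 - σ / K := by linarith
  have hσαK : 0 ≤ σ * α / K := by positivity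
  have hdet2 : 0 < 1 + σ * α / K := by linarith
  have hdet : 0 < (1 - σ / K) * (1 + σ * α / K) := mul_pos hdet1 hdet2
  have hv : α / K * A ≤ ut none := by
    calc α / K * A = (1 - σ) * (α / K) + σ * (ut (some z) * (α / K)) := by rw [hAdef]; ring
      _ ≤ ut none := hun
  have hAkey : (1 - σ) ≤ A * ((1 - σ / K) * (1 + σ * α / K)) := by
    -- from `huz` and `hv`: `ũ(z) ≥ ((1−α)/K)A + (σ/K)ũ(★) ≥ ((1−α)/K)A + (σα/K²)A`
    have h1 : (1 - α) / K * A + σ / K * ut none ≤ ut (some z) := by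
      calc (1 - α) / K * A + σ / K * ut none = (1 - σ) * ((1 - α) / K) + σ * (ut (some z) * ((1 - α) / K) + ut none * (1 / K)) := by
            rw [hAdef]; ring
        _ ≤ ut (some z) := huz
    have h2 : σ / K * (α / K * A) ≤ σ / K * ut none := mul_le_mul_of_nonneg_left hv (by positivity)
    have h3 : (1 - α) / K * A + σ / K * (α / K * A) ≤ ut (some z) := by linarith
    have h4 : σ * ((1 - α) / K * A + σ / K * (α / K * A)) ≤ σ * ut (some z) := mul_le_mul_of_nonneg_left h3 hσ0
    calc (1 - σ) = A - σ * ut (some z) := by rw [hAdef]; ring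
      _ ≤ A - σ * ((1 - α) / K * A + σ / K * (α / K * A)) := by linarith
      _ = A * ((1 - σ / K) * (1 + σ * α / K)) := by ring
  -- the incomes at `z` and at ★
  have hhold : PX (some z) (some z) ≤ (NC z : ℝ) / K := by
    rw [hPzz, hz1]; push_cast; exact div_le_div_of_nonneg_right (by linarith) hK0.le
  have hslz := costSide_slack_ge hW hp0 hp hθ hacc hPXoff hPXin hK1 hM hrn hrs hΛn hΛs hsl hz hhold
  have hle : ∀ w, NC w ≠ 0 → W w ≤ W z := fun w hw => by
    by_cases hwz : w = z
    · rw [hwz]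
    · exact (hbelow w hwz hw).le
  have hsls := costSide_residual_slack_none hW hp0 hp hθ hacc hPXout hPXstay hK hNC hM hrn hrs hΛn hΛs hsl hle (z := z)
  have hθza := costSide_residual_theta hW hp0 hp hθ hza.le (θ := θ)
  rw [← hαeq] at hθza
  set slz := α * ((K : ℝ) - 2 + 3 * θ a) / K with hslzdef
  set sls := (1 - α) * (1 - θ a) / (1 + α) with hslsdef
  have hslz0 : 0 ≤ slz := by
    rw [hslzdef]
    have h1 : 0 ≤ (K : ℝ) - 2 + 3 * θ a := by linarith [(hθm a).1]
    exact div_nonneg (mul_nonneg hα0 h1) hK0.le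
  have hsls0 : 0 ≤ sls := by rw [hslsdef]; have := (hθm a).2; exact div_nonneg (mul_nonneg (by linarith) (by linarith)) (by linarith)
  have hslz' : slz ≤ sl (some z) := hslz
  have hsls' : sls ≤ sl none := hθza.trans hsls
  -- `s1 ≥ A·slz + σ·ũ(★)·sls ≥ A(slz + σ(α/K)sls) ≥ (1−σ)(slz + σ(α/K)sls)/det`
  have hs1 : (1 - σ) * (slz + σ * (α / K) * sls) / ((1 - σ / K) * (1 + σ * α / K))
      ≤ (K + M) * ut none - (∑ v, ut (some v) * (1 - θ v) + ut none * (1 - θ a)) := by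
    rw [hs1eq, div_le_iff₀ hdet]
    have h1 : A * slz ≤ (1 - σ) * sl (some z) + σ * (ut (some z) * sl (some z)) := by
      have e : (1 - σ) * sl (some z) + σ * (ut (some z) * sl (some z)) = A * sl (some z) := by rw [hAdef]; ring
      rw [e]; exact mul_le_mul_of_nonneg_left hslz' hA0
    have h2 : σ * (α / K * A) * sls ≤ σ * (ut none * sl none) := by
      rw [mul_assoc]
      exact mul_le_mul_of_nonneg_left (mul_le_mul hv hsls' hsls0 (hut0 none)) hσ0
    have h3 : A * (slz + σ * (α / K) * sls) ≤ (1 - σ) * sl (some z) + σ * ∑ t, ut t * sl t + (1 - σ) * ((1 - θ a) * ut none) := by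
      have := mul_le_mul_of_nonneg_left hE hσ0
      linarith [h1, h2, this, htail0]
    have h4 : 0 ≤ slz + σ * (α / K) * sls := by positivity
    calc (1 - σ) * (slz + σ * (α / K) * sls) ≤ A * ((1 - σ / K) * (1 + σ * α / K)) * (slz + σ * (α / K) * sls) :=
          mul_le_mul_of_nonneg_right hAkey h4
      _ = A * (slz + σ * (α / K) * sls) * ((1 - σ / K) * (1 + σ * α / K)) := by ring
      _ ≤ _ := mul_le_mul_of_nonneg_right h3 hdet.le
  -- `L ≤ 4K + 2`, `L ≥ 0`
  have hMC : ∑ v, θ v * (NC v : ℝ) ≤ K := by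
    calc ∑ v, θ v * (NC v : ℝ) ≤ ∑ v, (NC v : ℝ) := sum_le_sum fun v _ =>
            mul_le_of_le_one_left (Nat.cast_nonneg _) (hθm v).2
      _ = K := by exact_mod_cast hNC
  have hMC0 : 0 ≤ ∑ v, θ v * (NC v : ℝ) := sum_nonneg fun v _ => mul_nonneg (by linarith [(hθm v).1]) (Nat.cast_nonneg _)
  have hL0 : 0 ≤ L := by rw [hL, hM]; linarith only [hMC0, (hθm a).1, (hθm b).1, hK0]
  have hL4 : L ≤ 4 * K + 2 := by rw [hL, hM]; linarith only [hMC, (hθm a).2, (hθm b).2]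
  -- the scalar inequality and the chain
  have hscal := costSide_scalar_residual hK2r hL4 hα0 hα1 (hθm a).1 hσ0 hσ1.le (α := α)
  rw [← hαeq] at hDJ
  calc L * ∑ n ∈ range J, (1 - σ) * σ ^ n * max 0 (y (n + 1) (some z) - x (n + 1) (some z))
      ≤ L * ((1 - σ) * (α / (1 + α) * (1 / (K : ℝ)) * (σ * (1 / (K : ℝ)) / (1 - (σ * (1 / (K : ℝ))) ^ 2)))) :=
        mul_le_mul_of_nonneg_left hDJ hL0
    _ = (1 - σ) * (L * (α / (1 + α) * (1 / (K : ℝ)) * (σ * (1 / (K : ℝ)) / (1 - (σ * (1 / (K : ℝ))) ^ 2)))) := by ring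
    _ ≤ (1 - σ) * (2 * ((α * ((K : ℝ) - 2 + 3 * θ a) / K + σ * (α / K) * ((1 - α) * (1 - θ a) / (1 + α)))
          / ((1 - σ / K) * (1 + σ * α / K)))) := mul_le_mul_of_nonneg_left hscal (by linarith only [hσ1])
    _ = 2 * ((1 - σ) * (slz + σ * (α / K) * sls) / ((1 - σ / K) * (1 + σ * α / K))) := by rw [hslzdef, hslsdef]; ring
    _ ≤ 2 * ((K + M) * ut none - (∑ v, ut (some v) * (1 - θ v) + ut none * (1 - θ a))) := mul_le_mul_of_nonneg_left hs1 (by norm_num)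

/-- **CONJECTURE W′ FOR THE RESIDUAL PAIR, EVERY `K ≥ 2`:** `cost(x̃) + cost(ỹ) ≤ L·(x̃(★) + (x̃(a) − ỹ(a)) − D_J)` for every truncation `J`. [ours] -/
theorem tagged_perAttempt_certificate_residual (hW : ∀ v, 0 < W v) (hp0 : 0 ≤ p) (hp : ∀ v, p * W v ≤ 1) (hθ : ∀ v, θ v = 1 / (1 + p * W v))
    (hacc : ∀ h v, acc h v = min 1 (W h / W v)) (hK : 2 ≤ K) (hNC : ∑ v, NC v = K) (hab : W b ≤ W a)
    (hnone : ∀ w, NC w ≠ 0 → ¬ (W b < W w ∧ W w < W a))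
    (hPXoff : ∀ h v, h ≠ v → PX (some h) (some v) = if NC h = 0 then 0 else (NC v : ℝ) / K * acc h v)
    (hPXin : ∀ h, PX (some h) none = if NC h = 0 then 0 else acc h a / K)
    (hPXdiag : ∀ h, PX (some h) (some h) = 1 - (∑ v ∈ univ.erase h, PX (some h) (some v) + PX (some h) none))
    (hPXout : ∀ v, PX none (some v) = (NC v : ℝ) / K * acc a v) (hPXstay : PX none none = 1 - ∑ v, PX none (some v))
    (hPYoff : ∀ h v, h ≠ v → PY (some h) (some v) = if NC h = 0 then 0 else (NC v : ℝ) / K * acc h v)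
    (hPYin : ∀ h, PY (some h) none = if NC h = 0 then 0 else acc h b / K)
    (hPYdiag : ∀ h, PY (some h) (some h) = 1 - (∑ v ∈ univ.erase h, PY (some h) (some v) + PY (some h) none))
    (hPYout : ∀ v, PY none (some v) = (NC v : ℝ) / K * acc b v) (hPYstay : PY none none = 1 - ∑ v, PY none (some v))
    {z : S} (hz1 : NC z = 1) (hzb : W z ≤ W b) (hza : W z < W a) (hbelow : ∀ w, w ≠ z → NC w ≠ 0 → W w < W z)
    {x y : ℕ → Option S → ℝ}
    (hx0 : ∀ v, x 0 v = if v = some z then 1 else 0) (hxs : ∀ n v, x (n + 1) v = ∑ h, x n h * PX h v)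
    (hy0 : ∀ v, y 0 v = if v = some z then 1 else 0) (hys : ∀ n v, y (n + 1) v = ∑ h, y n h * PY h v)
    {M : ℝ} (hM : M = ∑ v, θ v * (NC v : ℝ) + θ a) {L : ℝ} (hL : L = 2 * K + M + (∑ v, θ v * (NC v : ℝ) + θ b))
    {σ : ℝ} (hσ0 : 0 ≤ σ) (hσ1 : σ < 1) {xt yt xs ys : Option S → ℝ}
    (hxt : ∀ t, xt t = (1 - σ) * PX (some z) t + σ * ∑ t', xt t' * PX t' t) (hyt : ∀ t, yt t = (1 - σ) * PY (some z) t + σ * ∑ t', yt t' * PY t' t)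
    (hxsr : ∀ t, xs t = (1 - σ) * PX none t + σ * ∑ t', xs t' * PX t' t) (hysr : ∀ t, ys t = (1 - σ) * PY none t + σ * ∑ t', ys t' * PY t' t) (J : ℕ) :
    (∑ v, xt (some v) * (1 - θ v) + xt none * (1 - θ a)) + (∑ v, yt (some v) * (1 - θ v) + yt none * (1 - θ b))
      ≤ L * (xt none + (xt (some a) - yt (some a)) - ∑ n ∈ range J, (1 - σ) * σ ^ n * max 0 (y (n + 1) (some z) - x (n + 1) (some z))) := by
  have hz : NC z ≠ 0 := by rw [hz1]; exact one_ne_zero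
  have hK1 : 1 ≤ K := by omega
  have hθm := theta_mem hW hp0 hp hθ
  have hMY : (∑ v, θ v * (NC v : ℝ) + θ b) = M + (θ b - θ a) := by rw [hM]; ring
  have hdec := ledger_perStep_eq (θ := θ) (x := xt) (y := yt) (z := z) (a := a)
    (pen := ∑ n ∈ range J, (1 - σ) * σ ^ n * max 0 (y (n + 1) (some z) - x (n + 1) (some z))) hMY hL
  have hDstar := tagged_star_domination hW hacc hK1 hNC hab hPXoff hPXin hPXdiag hPXout hPXstay hPYoff hPYin hPYdiag hPYout hPYstay hσ0 hσ1 hxsr hysr z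
  have hs3 := S2_of_star_domination hW hp0 hp hθ hacc hK1 hNC hab hPXoff hPXin hPXdiag hPXout hPXstay hPYoff hPYin hPYout hσ0 hσ1 hz hxt hyt hxsr hysr hDstar
  have hdom := tagged_hub_domination hW hacc hK1 hNC hab hPXoff hPXin hPXdiag hPXout hPXstay hPYoff hPYin hPYdiag hPYout hPYstay hσ0 hσ1 hz hxt hyt
  have hgap_a : 0 ≤ xt (some a) - yt (some a) := by linarith [hdom a]
  have hgaps : 0 ≤ ∑ v ∈ univ.erase z, (xt (some v) - yt (some v)) * (1 - θ v) :=
    sum_nonneg fun v _ => mul_nonneg (by linarith [hdom v]) (by linarith [(hθm v).2])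
  have hez : 0 ≤ -((1 - θ z) * (yt (some z) - xt (some z))) := by
    have h1 : 0 ≤ 1 - θ z := by linarith [(hθm z).2]
    have h2 : yt (some z) - xt (some z) ≤ 0 := by linarith [hdom z]
    nlinarith [mul_nonneg h1 (neg_nonneg.mpr h2)]
  have hcost := tagged_costSide_residual hW hp0 hp hθ hacc hK hNC hab hnone hPXoff hPXin hPXdiag hPXout hPXstay hPYoff hPYin hPYdiag hPYout hPYstay
    hz1 hzb hza hbelow hx0 hxs hy0 hys hM hL hσ0 hσ1 hxt J
  have hMC0 : 0 ≤ ∑ v, θ v * (NC v : ℝ) := sum_nonneg fun v _ => mul_nonneg (by linarith [(hθm v).1]) (Nat.cast_nonneg _)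
  have hL0 : 0 ≤ L := by
    have hK0 : (0 : ℝ) ≤ K := Nat.cast_nonneg _
    rw [hL, hM]; nlinarith [(hθm a).1, (hθm b).1]
  have key : 0 ≤ L * (xt none + (xt (some a) - yt (some a)) - ∑ n ∈ range J, (1 - σ) * σ ^ n * max 0 (y (n + 1) (some z) - x (n + 1) (some z)))
      - (∑ v, xt (some v) * (1 - θ v) + xt none * (1 - θ a)) - (∑ v, yt (some v) * (1 - θ v) + yt none * (1 - θ b)) := by
    rw [hdec]
    have hga : 0 ≤ L * (xt (some a) - yt (some a)) := mul_nonneg hL0 hgap_a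
    linarith [hs3, hga, hgaps, hez, hcost]
  linarith

end ResidualCost

end Summit.Ventures.LatticeQCDFlow.Scaling
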